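import Summits.HodgeConjecture.HodgeConjecture.Theorems.K2E3WittParabolicBlocks
import Literature.NumberTheory.Automorphic.ValuedFieldValuativeRelBridge
import Literature.NumberTheory.Automorphic.HeckeTransversalGL
import HarnessLib

/-!
# The maximal parabolic `Q_c` of `U(σ, W)`, `W = wittFormOn e Han` (any anisotropic kernel) — II: the inverse Witt form, `U`-packaging of the
# Levi blocks, RIGIDITY of block-diagonal `W`-unitary matrices, and integrality by entries (crux H413, 13a road A, (D)-prep)

Cell `hodgecm-mathlib`, Track B, line `K2_E3_EllipticInputs`, 13a road A; seat K2E3-p10 (g3).  THEOREMS ONLY; count-neutral helper.  Sequel of ★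
`K2E3WittParabolicBlocks` (entries of `W`, `midBlock_unitary_witt`, `blockDiagMatrix_unitary_witt`).

* §1 `wittForm_mul_wittForm`, `wittFormOn_mul_wittFormOn` — `W(Han) · W(Han′) = 1` whenever `Han · Han′ = 1` (the Witt form with kernel `Han⁻¹` is
  the inverse matrix; no standard-indexing hypothesis).
* §2 `exists_unitary_coe_eq` — a matrix `M` with `σ(M)ᵀ W M = W` IS an element of `U(σ, W)` (inverse `W(Han⁻¹) σ(M)ᵀ W`), for `det Han` a unit;
  `exists_unitary_coe_eq_midBlock` (the Levi projection `Q_c → U(σ, W′)` on elements), `exists_unitary_coe_eq_blockDiagMatrix` (the lift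
  `GL_c × U(σ, W′) → U(σ, W)`, `(A, g′) ↦ diag(A, g′, A†)`).
* §3 RIGIDITY: for a block-DIAGONAL `W`-unitary matrix the last block is forced by the first (`σ(A)ᵀ · X = P`, `X_{kj} = M_{hi(rev k), hi j}`,
  `P = (δ_{j, rev i})`, `P² = 1`): `sum_loBlock_hiBlock_eq_witt`, `hiBlock_eq_of_loBlock_eq_witt`, and **`eq_of_loBlock_eq_of_midBlock_eq_witt`** — two
  block-diagonal `W`-unitary matrices with the same first and middle blocks are equal (the `W`-analogue of ★ `eq_of_loBlockGL_eq_of_midBlockU_eq`).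
* §5 (appended) `isUnit_det_wittFormOn`, `det_wittFormOn_ne_zero` — `det W_e(Han)` is a unit when `det Han` is (the `hH` of §4).
* §4 `v_det_eq_one_of_mem_unitaryGroupOfForm`, **`mem_unitaryInt_iff_forall_v_le_one_of_det_ne_zero`** — for ANY form `H` with `det H ≠ 0` and
  `σ` isometric, `K₀ = U(σ,H) ∩ GL_n(𝒪)` (★ `unitaryInt`) is cut out by the ENTRIES alone (`|det g| = 1`, inverse `= det⁻¹ · adj`; `ValuativeRel`
  bridge ★ `mem_glInt_of_isIntegralMatrix`).  This replaces the `J₀`-only ★ `mem_unitaryInt_iff_forall_v_le_one` for non-unimodular kernels.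

Purpose: the Levi Cartan recursion for Witt type `m = 2` (peel the first `GL` block of a block-diagonal element of `U(σ, W)`, as ★
`K2E3WittLeviCartanRecursion` does for `J₀`) over the (D) lattice theory.

References: F. Bruhat, J. Tits (1972), (4.4.3); J. Rogawski (1990), §1.9–§1.10; A. Borel (1991), §23; J.-P. Serre, *Local Fields* (1979), Ch. II §1.
-/

set_option autoImplicit false
set_option linter.dupNamespace false

noncomputable section

open scoped Matrix MatrixGroups Valued WithZero
open Matrix

namespace Summit.HodgeConjecture.HodgeConjecture.Cruxes.H413.K2E3WittParabolicBlocksLift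

open Literature.NumberTheory.Automorphic Literature.NumberTheory.Automorphic.HermitianLattice
open K2E3LocalUnitaryWitt K2E3WittCartanUnramified K2E3WittParabolicBlocks

/-! ## §1 The inverse of the Witt form -/

section Inverse

variable {R : Type*} [CommRing R] {r m : ℕ}

/-- **`W(Han) · W(Han′) = 1` when `Han · Han′ = 1`**: the outer antidiagonal frame squares to `1`, the kernel block multiplies.
[cite: Dieudonne1971GroupesClassiques, Chap. I §11] -/
theorem wittForm_mul_wittForm {Han Han' : Matrix (Fin m) (Fin m) R} (h : Han * Han' = 1) : wittForm r Han * wittForm r Han' = 1 := by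
  ext x y
  rw [Matrix.mul_apply, Fintype.sum_sum_type, Fintype.sum_sum_type]
  rcases x with i | u | j
  · simp only [wittForm_inl_inl, zero_mul, Finset.sum_const_zero, zero_add, wittForm_inl_inr_inl, wittForm_inl_inr_inr]
    rw [Finset.sum_eq_single (Fin.rev i)]
    · rw [if_pos (Fin.rev_rev i).symm, one_mul]
      rcases y with i' | u' | j'
      · rw [wittForm_inr_inr_inl, Matrix.one_apply]
        exact if_congr (by rw [Fin.rev_inj, Sum.inl.injEq]) rfl rfl
      · rw [wittForm_inr_inr_inr_inl, Matrix.one_apply_ne (by simp)]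
      · rw [wittForm_inr_inr_inr_inr, Matrix.one_apply_ne (by simp)]
    · intro j' _ hj'; rw [if_neg (fun h' => hj' (by rw [h', Fin.rev_rev])), zero_mul]
    · exact fun h' => absurd (Finset.mem_univ _) h'
  · simp only [wittForm_inr_inl_inl, zero_mul, Finset.sum_const_zero, zero_add, wittForm_inr_inl_inr_inr, add_zero,
      wittForm_inr_inl_inr_inl]
    rcases y with i' | u' | j'
    · simp only [wittForm_inr_inl_inl, mul_zero, Finset.sum_const_zero]; rw [Matrix.one_apply_ne (by simp)]
    · rw [Matrix.one_apply]
      simp only [wittForm_inr_inl_inr_inl, Sum.inr.injEq, Sum.inl.injEq]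
      rw [← Matrix.mul_apply, h, Matrix.one_apply]
    · simp only [wittForm_inr_inl_inr_inr, mul_zero, Finset.sum_const_zero]; rw [Matrix.one_apply_ne (by simp)]
  · simp only [wittForm_inr_inr_inr_inl, wittForm_inr_inr_inr_inr, zero_mul, Finset.sum_const_zero, add_zero, wittForm_inr_inr_inl]
    rw [Finset.sum_eq_single (Fin.rev j)]
    · rw [if_pos (Fin.rev_rev j).symm, one_mul]
      rcases y with i' | u' | j'
      · rw [wittForm_inl_inl, Matrix.one_apply_ne (by simp)]
      · rw [wittForm_inl_inr_inl, Matrix.one_apply_ne (by simp)]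
      · rw [wittForm_inl_inr_inr, Matrix.one_apply]
        exact if_congr (by rw [Fin.rev_inj, Sum.inr.injEq, Sum.inr.injEq]) rfl rfl
    · intro i' _ hi'; rw [if_neg (fun h' => hi' (by rw [h', Fin.rev_rev])), zero_mul]
    · exact fun h' => absurd (Finset.mem_univ _) h'

/-- **`W_e(Han) · W_e(Han′) = 1`** on any carrier (transport of `wittForm_mul_wittForm`). [cite: Dieudonne1971GroupesClassiques, Chap. I §11] -/
theorem wittFormOn_mul_wittFormOn {n : Type*} [Fintype n] [DecidableEq n] (e : WittIndex r m ≃ n) {Han Han' : Matrix (Fin m) (Fin m) R}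
    (h : Han * Han' = 1) : wittFormOn e Han * wittFormOn e Han' = 1 := by
  rw [wittFormOn, wittFormOn, Matrix.reindex_apply, Matrix.reindex_apply, Matrix.submatrix_mul_equiv, wittForm_mul_wittForm h,
    Matrix.submatrix_one_equiv]

end Inverse

/-! ## §2 Packaging matrices as elements of `U(σ, W)` -/

section Package

variable {K : Type*} [Field K] {σ : K →+* K} {N r m : ℕ} (e : WittIndex r m ≃ Fin N)
  (hstd : ∀ x, (e x).val = Sum.elim (fun i : Fin r => i.val) (Sum.elim (fun u : Fin m => r + u.val) (fun j : Fin r => r + m + j.val)) x)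
  (Han : Matrix (Fin m) (Fin m) K)

/-- **A matrix with `σ(M)ᵀ W M = W` is an element of `U(σ, W)`** (`det Han` a unit): its inverse is `W(Han⁻¹) σ(M)ᵀ W`.
[cite: Rogawski1990, §1.9 p. 13] -/
theorem exists_unitary_coe_eq (hHan : IsUnit Han.det) {M : Matrix (Fin N) (Fin N) K}
    (h : (M.map σ)ᵀ * wittFormOn e Han * M = wittFormOn e Han) :
    ∃ g : unitaryGroupOfForm σ (wittFormOn e Han), ((g : GL (Fin N) K) : Matrix (Fin N) (Fin N) K) = M := by
  have hinv : Han⁻¹ * Han = 1 := Matrix.nonsing_inv_mul Han hHan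
  have h2 : wittFormOn e Han⁻¹ * (M.map σ)ᵀ * wittFormOn e Han * M = 1 := by
    rw [Matrix.mul_assoc, Matrix.mul_assoc, ← Matrix.mul_assoc (M.map σ)ᵀ, h, wittFormOn_mul_wittFormOn e hinv]
  exact ⟨⟨⟨M, wittFormOn e Han⁻¹ * (M.map σ)ᵀ * wittFormOn e Han, mul_eq_one_comm.1 h2, h2⟩, mem_unitaryGroupOfForm_iff.2 h⟩, rfl⟩

variable {c : ℕ} (hcr : c ≤ r) (hc : 2 * c ≤ N) (hN' : (r - c) + (m + (r - c)) = N - 2 * c)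

include hstd hcr in
/-- **The Levi projection `Q_c → U(σ, W′)` on elements**: the middle block of a block upper triangular element of `U(σ, W)` is (the matrix of)
an element of `U(σ, W′)`, `W′` the shifted Witt form. [cite: Rogawski1990, §1.10] [cite: BruhatTits1972, (4.4.3)] -/
theorem exists_unitary_coe_eq_midBlock (hHan : IsUnit Han.det) (q : unitaryGroupOfForm σ (wittFormOn e Han))
    (hq : ((q : GL (Fin N) K) : Matrix (Fin N) (Fin N) K).BlockTriangular (blockLabel N c)) :
    ∃ g' : unitaryGroupOfForm σ (wittFormOn (stdWittEquivFin (r - c) m hN') Han),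
      ((g' : GL (Fin (N - 2 * c)) K) : Matrix (Fin (N - 2 * c)) (Fin (N - 2 * c)) K) =
        midBlock hc ((q : GL (Fin N) K) : Matrix (Fin N) (Fin N) K) :=
  exists_unitary_coe_eq _ Han hHan (midBlock_unitary_witt e hstd Han hcr hc hN' σ hq (mem_unitaryGroupOfForm_iff.1 q.2))

include hstd hcr in
/-- **The block-diagonal lift `(A, g′) ↦ diag(A, g′, A†) ∈ U(σ, W)`** of `A ∈ GL_c(K)` and `g′ ∈ U(σ, W′)` (`σ` an involution, `det Han` a unit).
[cite: Rogawski1990, §1.10] [cite: BruhatTits1972, (4.4.3)] -/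
theorem exists_unitary_coe_eq_blockDiagMatrix (hσ : ∀ x, σ (σ x) = x) (hHan : IsUnit Han.det) (A : GL (Fin c) K)
    (g' : unitaryGroupOfForm σ (wittFormOn (stdWittEquivFin (r - c) m hN') Han)) :
    ∃ L : unitaryGroupOfForm σ (wittFormOn e Han), ((L : GL (Fin N) K) : Matrix (Fin N) (Fin N) K) =
      blockDiagMatrix hc (A : Matrix (Fin c) (Fin c) K) ((g' : GL (Fin (N - 2 * c)) K) : Matrix (Fin (N - 2 * c)) (Fin (N - 2 * c)) K)
        (dualBlock σ ((A⁻¹ : GL (Fin c) K) : Matrix (Fin c) (Fin c) K)) :=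
  exists_unitary_coe_eq e Han hHan
    (blockDiagMatrix_unitary_witt e hstd Han hcr hc hN' σ hσ (coe_inv_mul_coe_gl A) (mem_unitaryGroupOfForm_iff.1 g'.2))

end Package

/-! ## §3 Rigidity: the last block of a block-diagonal `W`-unitary matrix is forced by the first -/

section Rigidity

variable {K : Type*} [Field K] (σ : K →+* K) {N r m : ℕ} (e : WittIndex r m ≃ Fin N)
  (hstd : ∀ x, (e x).val = Sum.elim (fun i : Fin r => i.val) (Sum.elim (fun u : Fin m => r + u.val) (fun j : Fin r => r + m + j.val)) x)
  (Han : Matrix (Fin m) (Fin m) K) {c : ℕ} (hcr : c ≤ r) (hc : 2 * c ≤ N)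

include hstd hcr in
/-- **Unitarity at `(castLE i, hiIndex j)` for a block-diagonal `W`-unitary `M`**: `Σ_k σ(M_{castLE k, castLE i}) · M_{hiIndex (rev k), hiIndex j}
= [j = rev i]` (only first-block rows contribute). [cite: Rogawski1990, §1.9–§1.10] -/
theorem sum_loBlock_hiBlock_eq_witt {M : Matrix (Fin N) (Fin N) K} (hM : (M.map σ)ᵀ * wittFormOn e Han * M = wittFormOn e Han)
    (hM0 : ∀ {p q : Fin N}, blockLabel N c p ≠ blockLabel N c q → M p q = 0) (i j : Fin c) :
    ∑ k : Fin c, σ (M (Fin.castLE (le_of_two_mul_le hc) k) (Fin.castLE (le_of_two_mul_le hc) i)) * M (hiIndex hc (Fin.rev k)) (hiIndex hc j) =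
      if j = Fin.rev i then 1 else 0 := by
  have hN' : (r - c) + (m + (r - c)) = N - 2 * c := by
    have hN : N = r + (m + r) := by simpa using (Fintype.card_congr e).symm
    omega
  have h := congrFun (congrFun hM (Fin.castLE (le_of_two_mul_le hc) i)) (hiIndex hc j)
  have hmid : ∀ j₁ : Fin (N - 2 * c), σ (M (midIndex hc j₁) (Fin.castLE (le_of_two_mul_le hc) i)) = 0 := fun j₁ => by
    rw [hM0 (by rw [blockLabel_midIndex, blockLabel_castLE hc]; decide), map_zero]
  have hhi : ∀ k : Fin c, σ (M (hiIndex hc k) (Fin.castLE (le_of_two_mul_le hc) i)) = 0 := fun k => by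
    rw [hM0 (by rw [blockLabel_hiIndex hc, blockLabel_castLE hc]; decide), map_zero]
  rw [map_transpose_mul_wittFormOn_mul_apply e hstd Han hcr hc hN'] at h
  simp only [hmid, hhi, zero_mul, Finset.sum_const_zero, add_zero, rev_castLE hc] at h
  rw [h, wittFormOn_apply_of_blockLabel_ne_one e hstd Han hcr hc (by rw [blockLabel_castLE hc]; decide), rev_castLE hc]
  exact if_congr (hiIndex_injective hc).eq_iff rfl rfl

include hstd hcr in
/-- **The last block is forced**: two block-diagonal `W`-unitary matrices with the same first block have the same last block
(`σ(A)ᵀ X = P = σ(A)ᵀ X′` with `P² = 1`, so `σ(A)ᵀ` is invertible and `X = X′`). [cite: Rogawski1990, §1.9–§1.10] -/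
theorem hiBlock_eq_of_loBlock_eq_witt {M M' : Matrix (Fin N) (Fin N) K} (hM : (M.map σ)ᵀ * wittFormOn e Han * M = wittFormOn e Han)
    (hM' : (M'.map σ)ᵀ * wittFormOn e Han * M' = wittFormOn e Han) (hM0 : ∀ {p q : Fin N}, blockLabel N c p ≠ blockLabel N c q → M p q = 0)
    (hM'0 : ∀ {p q : Fin N}, blockLabel N c p ≠ blockLabel N c q → M' p q = 0)
    (hlo : loBlock hc M = loBlock hc M') (k j : Fin c) : M (hiIndex hc k) (hiIndex hc j) = M' (hiIndex hc k) (hiIndex hc j) := by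
  obtain ⟨X, hX⟩ : ∃ X : Matrix (Fin c) (Fin c) K, ∀ a b, X a b = M (hiIndex hc (Fin.rev a)) (hiIndex hc b) :=
    ⟨Matrix.of fun a b => M (hiIndex hc (Fin.rev a)) (hiIndex hc b), fun _ _ => rfl⟩
  obtain ⟨X', hX'⟩ : ∃ X' : Matrix (Fin c) (Fin c) K, ∀ a b, X' a b = M' (hiIndex hc (Fin.rev a)) (hiIndex hc b) :=
    ⟨Matrix.of fun a b => M' (hiIndex hc (Fin.rev a)) (hiIndex hc b), fun _ _ => rfl⟩
  obtain ⟨P, hP⟩ : ∃ P : Matrix (Fin c) (Fin c) K, ∀ a b, P a b = if b = Fin.rev a then 1 else 0 :=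
    ⟨Matrix.of fun a b => if b = Fin.rev a then 1 else 0, fun _ _ => rfl⟩
  have hAX : ((loBlock hc M).map σ)ᵀ * X = P := by
    ext a b
    rw [Matrix.mul_apply, hP]
    simp only [Matrix.transpose_apply, Matrix.map_apply, loBlock_apply, hX]
    exact sum_loBlock_hiBlock_eq_witt σ e hstd Han hcr hc hM hM0 a b
  have hAX' : ((loBlock hc M).map σ)ᵀ * X' = P := by
    ext a b
    rw [Matrix.mul_apply, hP, hlo]
    simp only [Matrix.transpose_apply, Matrix.map_apply, loBlock_apply, hX']
    exact sum_loBlock_hiBlock_eq_witt σ e hstd Han hcr hc hM' hM'0 a b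
  have hPP : P * P = 1 := by
    ext a b
    rw [Matrix.mul_apply, Matrix.one_apply, Finset.sum_eq_single (Fin.rev a)]
    · rw [hP, hP, if_pos rfl, one_mul, Fin.rev_rev]; exact if_congr eq_comm rfl rfl
    · intro x _ hx; rw [hP, if_neg hx, zero_mul]
    · exact fun h' => absurd (Finset.mem_univ _) h'
  have hR : ((loBlock hc M).map σ)ᵀ * (X * P) = 1 := by rw [← Matrix.mul_assoc, hAX, hPP]
  have hL : X * P * ((loBlock hc M).map σ)ᵀ = 1 := mul_eq_one_comm.1 hR
  have hXX' : X' = X := by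
    calc X' = X * P * ((loBlock hc M).map σ)ᵀ * X' := by rw [hL, Matrix.one_mul]
      _ = X * P * P := by rw [Matrix.mul_assoc, hAX']
      _ = X := by rw [Matrix.mul_assoc, hPP, Matrix.mul_one]
  have h := congrFun (congrFun hXX' (Fin.rev k)) j
  rw [hX, hX', Fin.rev_rev] at h
  exact h.symm

include hstd hcr in
/-- **RIGIDITY**: two block-diagonal `W`-unitary matrices with the same first and middle blocks are EQUAL (the `W`-analogue of ★
`eq_of_loBlockGL_eq_of_midBlockU_eq`: `diag(A, g′, D)` is unitary only for `D = A†`). [cite: Rogawski1990, §1.10] [cite: BruhatTits1972, (4.4.3)] -/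
theorem eq_of_loBlock_eq_of_midBlock_eq_witt {M M' : Matrix (Fin N) (Fin N) K} (hM : (M.map σ)ᵀ * wittFormOn e Han * M = wittFormOn e Han)
    (hM' : (M'.map σ)ᵀ * wittFormOn e Han * M' = wittFormOn e Han) (hM0 : ∀ {p q : Fin N}, blockLabel N c p ≠ blockLabel N c q → M p q = 0)
    (hM'0 : ∀ {p q : Fin N}, blockLabel N c p ≠ blockLabel N c q → M' p q = 0)
    (hlo : loBlock hc M = loBlock hc M') (hmid : midBlock hc M = midBlock hc M') : M = M' := by
  ext p q
  by_cases hpq : blockLabel N c p = blockLabel N c q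
  · obtain ⟨x, rfl⟩ := (blockSum hc).surjective p
    obtain ⟨y, rfl⟩ := (blockSum hc).surjective q
    rcases x with (x | x) | x <;> rcases y with (y | y) | y <;>
      simp only [blockSum_inl_inl, blockSum_inl_inr, blockSum_inr, blockLabel_castLE hc, blockLabel_midIndex hc,
        blockLabel_hiIndex hc] at hpq ⊢
    all_goals first
      | exact absurd hpq (by decide)
      | (have h := congrFun (congrFun hlo x) y; rwa [loBlock_apply, loBlock_apply] at h)
      | (have h := congrFun (congrFun hmid x) y; rwa [midBlock_apply, midBlock_apply] at h)
      | exact hiBlock_eq_of_loBlock_eq_witt σ e hstd Han hcr hc hM hM' hM0 hM'0 hlo x y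
  · rw [hM0 hpq, hM'0 hpq]

end Rigidity

/-! ## §4 Integrality by entries for a general form -/

section Integral

variable {K : Type*} [Field K] [Valued K ℤᵐ⁰] {σ : K →+* K} {n : ℕ}

/-- **`|det g| = 1` on `U(σ, H)`** (`σ` isometric, `det H ≠ 0`): `σ(det g) · det H · det g = det H`. [cite: Rogawski1990, §1.9] -/
theorem v_det_eq_one_of_mem_unitaryGroupOfForm (hvσ : ∀ x, Valued.v (σ x) = Valued.v x) {H : Matrix (Fin n) (Fin n) K} (hH : H.det ≠ 0)
    (g : unitaryGroupOfForm σ H) : Valued.v ((g : GL (Fin n) K) : Matrix (Fin n) (Fin n) K).det = 1 := by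
  have h := congrArg Matrix.det (mem_unitaryGroupOfForm_iff.1 g.2)
  rw [Matrix.det_mul, Matrix.det_mul, Matrix.det_transpose, ← RingHom.mapMatrix_apply, ← RingHom.map_det] at h
  have h3 : σ ((g : GL (Fin n) K) : Matrix (Fin n) (Fin n) K).det * ((g : GL (Fin n) K) : Matrix (Fin n) (Fin n) K).det * H.det = 1 * H.det := by
    rw [mul_right_comm, one_mul]; exact h
  have h4 := congrArg Valued.v (mul_right_cancel₀ hH h3)
  rw [map_mul, hvσ, map_one, ← pow_two] at h4
  exact le_antisymm ((pow_le_one_iff two_ne_zero).1 h4.le) ((one_le_pow_iff two_ne_zero).1 h4.ge)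

variable [ValuativeRel K] [(Valued.v : Valuation K ℤᵐ⁰).Compatible]

/-- **`K₀ = U(σ, H) ∩ GL_n(𝒪)` is cut out by the entries alone**, for ANY form `H` with `det H ≠ 0` and isometric `σ`: an element of `U(σ, H)` with
integral entries has an integral inverse (`|det g| = 1` and `g⁻¹ = det⁻¹ · adj g`, ★ `mem_glInt_of_isIntegralMatrix`). [cite: Serre1979, Ch. II §1]
[cite: Tits1979, §3.3.3] -/
theorem mem_unitaryInt_of_forall_v_le_one (hvσ : ∀ x, Valued.v (σ x) = Valued.v x) {H : Matrix (Fin n) (Fin n) K} (hH : H.det ≠ 0)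
    {g : unitaryGroupOfForm σ H} (hg : ∀ i j, Valued.v (((g : GL (Fin n) K) : Matrix (Fin n) (Fin n) K) i j) ≤ 1) : g ∈ unitaryInt σ H := by
  refine mem_unitaryInt_iff.2 ⟨hg, ?_⟩
  have hdet := v_det_eq_one_of_mem_unitaryGroupOfForm hvσ hH g
  exact ((mem_glInt_iff_forall_v_le_one (g : GL (Fin n) K)).1 (mem_glInt_of_isIntegralMatrix
    (fun i j => (v_le_one_iff_mem_integer _).1 (hg i j)) ((v_eq_one_iff_valuation_eq_one _).1 hdet))).2

/-- `g ∈ K₀ ↔` all entries of `g` are integral (general form `H`, `det H ≠ 0`, `σ` isometric). [cite: Serre1979, Ch. II §1] [cite: Tits1979, §3.3.3] -/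
theorem mem_unitaryInt_iff_forall_v_le_one_of_det_ne_zero (hvσ : ∀ x, Valued.v (σ x) = Valued.v x) {H : Matrix (Fin n) (Fin n) K}
    (hH : H.det ≠ 0) (g : unitaryGroupOfForm σ H) :
    g ∈ unitaryInt σ H ↔ ∀ i j, Valued.v (((g : GL (Fin n) K) : Matrix (Fin n) (Fin n) K) i j) ≤ 1 :=
  ⟨fun h => (mem_unitaryInt_iff.1 h).1, mem_unitaryInt_of_forall_v_le_one hvσ hH⟩

end Integral

/-! ## §5 The Witt form is invertible when its kernel is -/

section Det

variable {K : Type*} [Field K] {N r m : ℕ} (e : WittIndex r m ≃ Fin N) {Han : Matrix (Fin m) (Fin m) K}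

/-- **`det W_e(Han)` is a unit when `det Han` is** (right inverse `W_e(Han⁻¹)`, §1). [cite: Dieudonne1971GroupesClassiques, Chap. I §11] -/
theorem isUnit_det_wittFormOn (hHan : IsUnit Han.det) : IsUnit (wittFormOn e Han).det :=
  Matrix.isUnit_det_of_right_inverse (wittFormOn_mul_wittFormOn e (Matrix.mul_nonsing_inv Han hHan))

/-- `det W_e(Han) ≠ 0` when `det Han` is a unit (the hypothesis `hH` of §4 for `H = wittFormOn e Han`). [cite: Dieudonne1971GroupesClassiques, Chap. I §11] -/
theorem det_wittFormOn_ne_zero (hHan : IsUnit Han.det) : (wittFormOn e Han).det ≠ 0 :=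
  (isUnit_det_wittFormOn e hHan).ne_zero

end Det

end Summit.HodgeConjecture.HodgeConjecture.Cruxes.H413.K2E3WittParabolicBlocksLift

end
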